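import Literature.MathematicalPhysics.QuantumFieldTheory.Balaban1983to89.B9LeafXCodedKnitU
import Literature.MathematicalPhysics.QuantumFieldTheory.Balaban1983to89.Node00.CarriersYUPar

/-!
# `Balaban1983to89.B9LeafXCodedKnitUPar` — CASCADE-K PIECE (director-ym №383): THE [B9] LEAF OVER THE CODED CARRIER, PARAMETRIC IN THE SITE TRANSPORTER `par`
# AND THE BOND-AVERAGE LETTER `OA` (the re-press ONCE of `B9LeafXCodedKnitU.b9LeafX_carriersYU` over node00-def-Y's `Node00.carriersYUPar`)

T. Bałaban, *Propagators for lattice gauge theories in a background field*, Commun. Math. Phys. **99** (1985) 389–434 [`Balaban1985BackgroundPropagators`, "B9"],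
Sect. 3: Thms 3.1–3.4 and Cors 3.5–3.6 pp. 397–408, Thms 3.7–3.15 pp. 409–432, the class (3.35)–(3.38) p. 396, the site transporter (3.19) p. 393; T. Bałaban,
*Averaging operations for lattice gauge theories*, Commun. Math. Phys. **98** (1985) 17–51 [`Balaban1985Averaging`], Prop. 2 p. 26 (print's knit transporter);
[4] = `Balaban1984PropagatorsII`, Props. 2.2, 2.3, 2.6 (the case `U = 1`).

statement-level bookkeeping over published theorems with citation tags; proofs where landed; nothing here is a claim about the Yang–Mills mass gap

WHY THIS FILE (cell context).  `B9LeafXCodedKnitU.b9LeafX_carriersYU` (seat n06-d g19) concludes `B9LeafX (carriersYU P G f b ιB C38 ops)`, and `Node00.carriersYU` PINS the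
carriers `G′ ∕ G ∕ C⁻¹ ∕ analyticity` to the SYMMETRISED site transporter `parSymY` and the straight bond average `GAY … parSymY parBY (GpY … parSymY)` independently of
`ops` (dag-n06-d LOCATED-K, 2026-08-30): the knit instance of record (`opsYNuStOfRecordV11KE`, transporter `parKnitY`, `G = GAQY (qKnitOfRecord …) …`) cannot be
leafed through it.  Director-ym №383 «GO CASCADE-K» (parametric, once): node00-def-Y's K0 `Node00.CarriersYUPar` makes the transporter `par` and the bond-average
letter `OA` PARAMETERS of the bundle (`carriersYU = carriersYUPar … (fun j => parSymY _) (fun j => GAY …)` by `rfl`); THIS FILE is the leaf lemma over it — the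
proof of `b9LeafX_carriersYU` VERBATIM (its §0 reindex lemmas and §1 `thm31Printed_codedU ∕ baseU1Printed_codedU`, dag-n06-c's `thm32∕33Printed_codedU`, the
architecture lemmas `B9.*` and the `*_coded` pull-backs were ALREADY parametric in the transporter and the letters; only the statement was pinned).

WHAT IS IN THE FILE (0 `def`, 0 `sorry`; standard axioms).
* ★★★ `b9LeafX_carriersYUPar` — `B9LeafX (carriersYUPar P G f b ιB C38 par OA ops)` from exactly the inputs of `b9LeafX_carriersYU` with the three pins and the coded
  Sect.-B step `hB` read at `(par, OA)`: `hGpPin : … (ops (f j)).Gp = kernelFamilyS … (GpY _ (par j)) (par j)`, `hGAPin : … (ops (f j)).GA = kernelFamilyB … (OA j) (parBY _)`,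
  `hCinvPin : … (ops (f j)).Cinv = CinvY P f G par j`, `hB : Thm32Printed … (CinvY P f G par) → Thm33Printed … → SectBStepU P f (d+1) c35Y G b par OA (fun j => parBY _) … (CinvY P f G par)`
  (= dag-n06-c's K1 target shape).  At `par := fun j => parSymY _`, `OA := fun j => GAY …` it IS `b9LeafX_carriersYU` (same term); at `par := fun j => parKnitY _`,
  `OA := fun j => GAQY _ (qKnitOfRecord …) (qsKnitOfRecord …) (parKnitY _) (GpPhysY _ (parKnitY _))` it leafs the knit certificate (K3).

HONEST SCOPE.  Composition of landed theorems and quantifier bookkeeping; nothing of [B9] is asserted or proved here beyond what the inputs say; the coded step, the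
pins, the rows and the [B6] block stay DISPLAYED hypotheses.  COUNT-NEUTRAL; N06 NOT discharged; one finite lattice programme at fixed `ε` — nothing continuum ∕ OS ∕
mass-gap ∕ Clay.  Cell `pub-ymgap` (HUMAN RULING D-0062), Track A node N06 [B9], seat `pub-ymgap-dag-n06-d` (g24), 2026-08-30.

RELATED IN THE TREE, NOT DUPLICATED: `B9LeafXCodedKnitU` (§0∕§1 lemmas and the `parSymY` leaf, USED BY NAME), `Node00.CarriersYUPar` (the parametric bundle, its `rfl`
faces), `B9SectBStepUOfMembersR`, `B9SectBCodedCarrierPullbacks`, `B9LeafKnitOn`, `B9` — all USED BY NAME.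
-/

noncomputable section

namespace Literature.MathematicalPhysics.QuantumFieldTheory.Balaban1983to89.B9LeafXCodedKnitUPar

open DagBinding (PrintedCarriers9X B9LeafX B6BlockParam)
open B9PinMembersKLevelV1 (MemberY geo9Y bg9Y)
open B9BackgroundsKLevelV1R (RegFamY bg9YR kernelFamilyR kernelFamilyRY siteKernelR fineKernelR rwExpansionR rwKernelExpansionR hKernelR hKernelRY)
open B9PinGeometryKLevelV1 (dOmegaY OmKY inΛY unitDistY InCubeY c35Y c35Y_pos dictAtOneY not_inCubeY)
open B9PinCarriersKLevelV1 (OperatorLayerY)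
open B9PinCarriersKLevelV1R (carriersYR)
open B9SectBCodedClassR (RegExtraY regC335 regC336 bg9YC)
open B9SectBCodedCarrier (Coding pullK pullS)
open B9SectBCodedCarrierPullbacks (pullF pullH pullRW pullRWK pullC pullPK pullPH pullPK₀ thm31Printed_coded thm37Printed_coded cor38Printed_coded thm39Printed_coded
  thm310Printed_coded thm311Printed_coded thm312Printed_coded thm313Printed_coded thm314Printed_coded thm314LocalPrinted_coded thm315FullPrinted_coded
  stmt349Printed_coded stmt3132Printed_coded)
open B9SectBGpFrameCodedYR (codingYx)
open B9SectBCodedReadingsUR (KSCU KACU SectBStepU)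
open B9SectBCodedChainAnR (IsAnKY)
open B9SectBKerFrameCodedYR (CinvY)
open B9SectBCodedClassGY (C37GY)
open B9SectBStepsKSCUR (KSCU_members_base KACU_members_base ineq342_346_347_congr thms_KSCU_base_iff)
open B9SectBGpTransferInYR (ineq343_345_congr)
open B9SectBStepUOfMembersR (thm32Printed_codedU thm33Printed_codedU)
open B9LeafKnitOn (baseU1_of_b6BlockParam_on)
open B9Eq360DeltaPrimeAY (AfldY)
open B6Ineq2142KLevelV1 (β)
open Node00 (SiteY BlkY IBondY CfgY SiteParY BondParY BondOpY GAY GpY parSymY parBY kernelFamilyS kernelFamilyB carriersYU carriersYUPar codingYU cqY)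
open B9LeafXCodedKnitU (thm37Printed_reindex cor38Printed_reindex thm39Printed_reindex thm310Printed_reindex thm311Printed_reindex thm312Printed_reindex thm313Printed_reindex thm314Printed_reindex thm314LocalPrinted_reindex thm315FullPrinted_reindex stmt349Printed_reindex stmt3132Printed_reindex baseU1Printed_reindex thm31Printed_reindex thm32Printed_reindex thm33Printed_reindex thm31Printed_codedU baseU1Printed_codedU)

variable {d ℓ : ℕ} {hd : 1 ≤ d + 1} {hL : Odd (ℓ + 1) ∧ 1 < ℓ + 1} {b₀ b₁ : ℝ} {Mstar : ℕ}
variable {𝔸 : Type} [NormedRing 𝔸] (P : RegExtraY d ℓ hd hL b₀ b₁ Mstar 𝔸) [NormedAlgebra ℂ 𝔸] [CompleteSpace 𝔸] (G : Subgroup 𝔸ˣ)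
  {J : Type} (f : J → MemberY d ℓ hd hL b₀ b₁ Mstar)
  (C38 : ∀ j : J, ℝ → CfgY 𝔸 (f j).toKIdx → AfldY 𝔸 (f j).toKIdx → Prop)

section Knit

variable {ι : Type} [Fintype ι] (b : Module.Basis ι ℝ 𝔸) (ιB : ∀ j : J, BlkY (f j).toKIdx → IBondY (f j).toKIdx)
  (par : ∀ j : J, SiteParY 𝔸 (f j).toKIdx) (OA : ∀ j : J, BondOpY 𝔸 (f j).toKIdx)
  (ops : ∀ x : MemberY d ℓ hd hL b₀ b₁ Mstar, OperatorLayerY d ℓ hd hL b₀ b₁ Mstar 𝔸 G x)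

/-- ★★★ **`B9LeafX (carriersYUPar P G f b ιB C38 par OA ops)` — THE [B9] LEAF OVER THE CODED CARRIER AT A SITE-TRANSPORTER PARAMETER `par` AND A BOND-AVERAGE
LETTER `OA`** (CASCADE-K, director-ym №383): `b9LeafX_carriersYU` with its three pins and the coded Sect.-B step read at `(par, OA)` — `hone`, the `U = 1` comparisons,
the null readings, the residual entries, the rows 15–26 at `(regC335 P, regC336 P)` and the [B6] block VERBATIM; proof verbatim (every lemma it calls was already
parametric).  Instances: `(parSymY, GAY …)` = the landed leaf; `(parKnitY, GAQY (qKnitOfRecord …) …)` = the knit certificate's leaf.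
[cite: Balaban1985BackgroundPropagators, Thms 3.1–3.15 pp.397–432, Thm 3.4 p.400, Cor. 3.5 proof p.407, p.410, (3.19) p.393; Balaban1985Averaging, Prop. 2 p.26; Balaban1984PropagatorsII, Props. 2.2, 2.3, 2.6] -/
theorem b9LeafX_carriersYUPar (δ₀ : ℝ) {Jt Kt : Type} (tree : Jt → B6.TreeData) (loc : Kt → B6.LocalOp)
    (hone : ∀ (j : J) (α₀ : ℝ), 0 < α₀ → regC335 𝔸 G P (f j) c35Y α₀ (bg9YC 𝔸 G P (f j)).one)
    (hGp_e : ∀ (x : MemberY d ℓ hd hL b₀ b₁ Mstar) (n : Fin 4) (lam : (geo9Y x).Loc) (y : (geo9Y x).Site),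
      (ops x).Gp.e n (bg9Y 𝔸 G x).one lam y ≤ (Node00.GpU x.toKIdx).e n lam y)
    (hGp_h1 : ∀ (x : MemberY d ℓ hd hL b₀ b₁ Mstar) (lam : (geo9Y x).Loc) (b : ℝ) (ζ : (geo9Y x).Cut),
      (ops x).Gp.h1 (bg9Y 𝔸 G x).one lam b ζ ≤ (Node00.GpU x.toKIdx).h1 lam b ζ)
    (hC : ∀ (x : MemberY d ℓ hd hL b₀ b₁ Mstar) (y y' : (geo9Y x).Site), |(ops x).Cinv.ker (bg9Y 𝔸 G x).one y y'| ≤ |(Node00.CinvU x.toKIdx).ker y y'|)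
    (hGA_e : ∀ (x : MemberY d ℓ hd hL b₀ b₁ Mstar) (n : Fin 4) (lam : (geo9Y x).Loc) (y : (geo9Y x).Site),
      (ops x).GA.e n (bg9Y 𝔸 G x).one lam y ≤ (Node00.GU x.toKIdx).e n lam y)
    (hGA_h1 : ∀ (x : MemberY d ℓ hd hL b₀ b₁ Mstar) (lam : (geo9Y x).Loc) (b : ℝ) (ζ : (geo9Y x).Cut),
      (ops x).GA.h1 (bg9Y 𝔸 G x).one lam b ζ ≤ (Node00.GU x.toKIdx).h1 lam b ζ)
    (hGA_e4 : ∀ (x : MemberY d ℓ hd hL b₀ b₁ Mstar) (lam : (geo9Y x).Loc) (y : (geo9Y x).Site),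
      (ops x).GA.e4 (bg9Y 𝔸 G x).one lam y ≤ (Node00.GU x.toKIdx).e4 lam y)
    (hGA_h2 : ∀ (x : MemberY d ℓ hd hL b₀ b₁ Mstar) (lam : (geo9Y x).Loc) (b : ℝ) (ζ : (geo9Y x).Cut),
      (ops x).GA.h2 (bg9Y 𝔸 G x).one lam b ζ ≤ (Node00.GU x.toKIdx).h2 lam b ζ)
    (hGA_l2 : ∀ (x : MemberY d ℓ hd hL b₀ b₁ Mstar) (n : Fin 6) (lam : (geo9Y x).Loc) (h : (geo9Y x).Cut),
      (ops x).GA.l2 n (bg9Y 𝔸 G x).one lam h ≤ (Node00.GU x.toKIdx).l2 n lam h)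
    (hE4 : ∀ (x : MemberY d ℓ hd hL b₀ b₁ Mstar) (lam : (geo9Y x).Loc), ¬ (lam.isRight = true) → ∀ y, (ops x).GA.e4 (bg9Y 𝔸 G x).one lam y ≤ 0)
    (hH2 : ∀ (x : MemberY d ℓ hd hL b₀ b₁ Mstar) (lam : (geo9Y x).Loc), ¬ (lam.isRight = true) →
      ∀ (β : ℝ) (ζ : (geo9Y x).Cut), (ops x).GA.h2 (bg9Y 𝔸 G x).one lam β ζ ≤ 0)
    (hGp : B9FromB6.ResidualGpAtOne geo9Y (bg9YR 𝔸 G (regC335 𝔸 G P) (regC336 𝔸 G P)) (fun x => kernelFamilyR (regC335 𝔸 G P) (regC336 𝔸 G P) (ops x).Gp))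
    (hGA : B9FromB6.ResidualGAGlobAtOne geo9Y (bg9YR 𝔸 G (regC335 𝔸 G P) (regC336 𝔸 G P)) (fun x => kernelFamilyR (regC335 𝔸 G P) (regC336 𝔸 G P) (ops x).GA))
    (hGpPin : ∀ j : J, kernelFamilyR (regC335 𝔸 G P) (regC336 𝔸 G P) (ops (f j)).Gp =
      kernelFamilyS (f j).toKIdx (bg9YC 𝔸 G P (f j)) (fun U => U) (GpY (f j).toKIdx (par j)) (par j))
    (hGAPin : ∀ j : J, kernelFamilyR (regC335 𝔸 G P) (regC336 𝔸 G P) (ops (f j)).GA =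
      kernelFamilyB (f j).toKIdx (bg9YC 𝔸 G P (f j)) (fun U => U)
        (OA j) (parBY (f j).toKIdx))
    (hCinvPin : ∀ j : J, siteKernelR (regC335 𝔸 G P) (regC336 𝔸 G P) (ops (f j)).Cinv = CinvY P f G par j)
    (hB : B9.Thm32Printed (d + 1) c35Y (fun j => geo9Y (f j)) (fun j => bg9YC 𝔸 G P (f j)) (CinvY P f G par) →
      B9.Thm33Printed c35Y (fun j => geo9Y (f j)) (fun j => bg9YC 𝔸 G P (f j))
        (fun j => kernelFamilyS (f j).toKIdx (bg9YC 𝔸 G P (f j)) (fun U => U) (GpY (f j).toKIdx (par j)) (par j))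
        (fun j => kernelFamilyB (f j).toKIdx (bg9YC 𝔸 G P (f j)) (fun U => U)
          (OA j) (parBY (f j).toKIdx)) →
      SectBStepU P f (d + 1) c35Y G b par
        OA (fun j => parBY (f j).toKIdx)
        (fun j => C37GY G (f j) (ιB j) (cqY d)) C38 (CinvY P f G par))
    (t37 : B9.Thm37Printed c35Y geo9Y (bg9YR 𝔸 G (regC335 𝔸 G P) (regC336 𝔸 G P)) (fun x => rwExpansionR (regC335 𝔸 G P) (regC336 𝔸 G P) (ops x).E37))
    (c38 : B9.Cor38Printed c35Y geo9Y (bg9YR 𝔸 G (regC335 𝔸 G P) (regC336 𝔸 G P)) (fun x => rwExpansionR (regC335 𝔸 G P) (regC336 𝔸 G P) (ops x).E37))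
    (t39 : B9.Thm39Printed (d + 1) c35Y geo9Y (bg9YR 𝔸 G (regC335 𝔸 G P) (regC336 𝔸 G P))
      (fun x => rwKernelExpansionR (regC335 𝔸 G P) (regC336 𝔸 G P) (ops x).EK39))
    (t310 : B9.Thm310Printed c35Y geo9Y (bg9YR 𝔸 G (regC335 𝔸 G P) (regC336 𝔸 G P)) (fun x => rwExpansionR (regC335 𝔸 G P) (regC336 𝔸 G P) (ops x).E310))
    (hsum : B9.RWSumsYieldIneqs geo9Y (bg9YR 𝔸 G (regC335 𝔸 G P) (regC336 𝔸 G P)) (fun x => rwExpansionR (regC335 𝔸 G P) (regC336 𝔸 G P) (ops x).E37)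
      (fun x => rwExpansionR (regC335 𝔸 G P) (regC336 𝔸 G P) (ops x).E310) (fun x => kernelFamilyR (regC335 𝔸 G P) (regC336 𝔸 G P) (ops x).Gp)
      (fun x => kernelFamilyR (regC335 𝔸 G P) (regC336 𝔸 G P) (ops x).GA))
    (hksum : B9.RWKernelSumYields (d + 1) geo9Y (bg9YR 𝔸 G (regC335 𝔸 G P) (regC336 𝔸 G P))
      (fun x => rwKernelExpansionR (regC335 𝔸 G P) (regC336 𝔸 G P) (ops x).EK39) (fun x => siteKernelR (regC335 𝔸 G P) (regC336 𝔸 G P) (ops x).Cinv))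
    (t311 : B9.Thm311Printed c35Y geo9Y (bg9YR 𝔸 G (regC335 𝔸 G P) (regC336 𝔸 G P)) (fun x => (ops x).PosDef))
    (t312 : B9.Thm312Printed (d + 1) c35Y geo9Y (bg9YR 𝔸 G (regC335 𝔸 G P) (regC336 𝔸 G P))
      (fun x => kernelFamilyR (regC335 𝔸 G P) (regC336 𝔸 G P) (ops x).GD) (fun x => kernelFamilyR (regC335 𝔸 G P) (regC336 𝔸 G P) (ops x).G₁)
      (fun x => hKernelR (regC335 𝔸 G P) (regC336 𝔸 G P) (ops x).H) (fun x => hKernelR (regC335 𝔸 G P) (regC336 𝔸 G P) (ops x).H₁)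
      (fun x K => (ops x).HasRWExp (kernelFamilyRY K)) (fun x K => (ops x).HasRWExpH (hKernelRY K)) (fun x K => (ops x).PosDefK (kernelFamilyRY K)))
    (t313 : B9.Thm313Printed c35Y geo9Y (bg9YR 𝔸 G (regC335 𝔸 G P) (regC336 𝔸 G P)) (fun x => kernelFamilyR (regC335 𝔸 G P) (regC336 𝔸 G P) (ops x).GG)
      (fun x K => (ops x).HasRWExp (kernelFamilyRY K)) (fun x K => (ops x).PosDefK (kernelFamilyRY K)))
    (t314 : B9.Thm314Printed c35Y geo9Y (bg9YR 𝔸 G (regC335 𝔸 G P) (regC336 𝔸 G P)) (fun x => kernelFamilyR (regC335 𝔸 G P) (regC336 𝔸 G P) (ops x).Kdiff)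
      dOmegaY)
    (t315 : B9.Thm315FullPrinted c35Y geo9Y (bg9YR 𝔸 G (regC335 𝔸 G P) (regC336 𝔸 G P)) (fun x => siteKernelR (regC335 𝔸 G P) (regC336 𝔸 G P) (ops x).Ck)
      inΛY unitDistY (fun x => (ops x).GivenBy3185) (fun x => (ops x).HasRWExpC))
    (s349 : B9.Stmt349Printed (d + 1) c35Y geo9Y (bg9YR 𝔸 G (regC335 𝔸 G P) (regC336 𝔸 G P))
      (fun x => fineKernelR (regC335 𝔸 G P) (regC336 𝔸 G P) (ops x).P349))
    (s3132 : B9.Stmt3132Printed (d + 1) c35Y geo9Y (bg9YR 𝔸 G (regC335 𝔸 G P) (regC336 𝔸 G P))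
      (fun x => siteKernelR (regC335 𝔸 G P) (regC336 𝔸 G P) (ops x).QGQinv) (fun x => siteKernelR (regC335 𝔸 G P) (regC336 𝔸 G P) (ops x).QG1Qinv))
    (t314loc : B9Thm314.Thm314LocalPrinted c35Y geo9Y (bg9YR 𝔸 G (regC335 𝔸 G P) (regC336 𝔸 G P))
      (fun x => kernelFamilyR (regC335 𝔸 G P) (regC336 𝔸 G P) (ops x).Kdiff) OmKY dOmegaY)
    (h6 : B6BlockParam (Node00.towerBlockOfRecord d ℓ hd hL b₀ b₁ δ₀ tree loc)) :
    B9LeafX (carriersYUPar P G f b ιB C38 par OA ops) := by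
  -- (1) at the record, over the full member family at the classes `(regC335 P, regC336 P)`: the `U ≡ 1` block from [B6], Thms 3.1 ∕ 3.2 ∕ 3.3 from rows 15–19
  have hbaseR : B9.BaseU1Printed (d + 1) geo9Y (bg9YR 𝔸 G (regC335 𝔸 G P) (regC336 𝔸 G P))
      (fun x => kernelFamilyR (regC335 𝔸 G P) (regC336 𝔸 G P) (ops x).Gp) (fun x => kernelFamilyR (regC335 𝔸 G P) (regC336 𝔸 G P) (ops x).GA)
      (fun x => siteKernelR (regC335 𝔸 G P) (regC336 𝔸 G P) (ops x).Cinv) :=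
    baseU1_of_b6BlockParam_on (carriersYR d ℓ hd hL b₀ b₁ Mstar 𝔸 G (regC335 𝔸 G P) (regC336 𝔸 G P) ops).toPrintedCarriers9
      (Node00.towerBlockOfRecord d ℓ hd hL b₀ b₁ δ₀ tree loc) rfl (fun x => ⟨x.toKIdx, x.hcfk⟩)
      (fun x => dictAtOneY x (kernelFamilyR (regC335 𝔸 G P) (regC336 𝔸 G P) (ops x).Gp) (kernelFamilyR (regC335 𝔸 G P) (regC336 𝔸 G P) (ops x).GA)
        (siteKernelR (regC335 𝔸 G P) (regC336 𝔸 G P) (ops x).Cinv) (hGp_e x) (hGp_h1 x) (hC x) (hGA_e x) (hGA_h1 x) (hGA_e4 x) (hGA_h2 x) (hGA_l2 x))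
      (fun _ => fun lam => lam.isRight = true) (fun x => B9GeoNormsKLevelModelSignsV1.modelSignsOn_geo9K x.toKIdx) hE4 hH2 hGp hGA h6
  have h31R := B9.thm31_of_thm37 c35Y geo9Y (bg9YR 𝔸 G (regC335 𝔸 G P) (regC336 𝔸 G P)) _ _ _ _ t37 hsum
  have h32R := B9.thm32_of_thm39 (d + 1) c35Y geo9Y (bg9YR 𝔸 G (regC335 𝔸 G P) (regC336 𝔸 G P)) _ _ t39 hksum
  have h33R := B9.thm33_of_thm37_310 c35Y geo9Y (bg9YR 𝔸 G (regC335 𝔸 G P) (regC336 𝔸 G P)) _ _ _ _ t37 t310 hsum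
  -- (2) along the subfamily, re-keyed to NODE 00's letter readings by the pins
  have eGp := funext hGpPin
  have eGA := funext hGAPin
  have eC := funext hCinvPin
  have hbaseJ := baseU1Printed_reindex f (d + 1) geo9Y (bg9YR 𝔸 G (regC335 𝔸 G P) (regC336 𝔸 G P)) _ _ _ hbaseR
  have h31J := thm31Printed_reindex f c35Y geo9Y (bg9YR 𝔸 G (regC335 𝔸 G P) (regC336 𝔸 G P)) _ h31R
  have h32J := thm32Printed_reindex f (d + 1) c35Y geo9Y (bg9YR 𝔸 G (regC335 𝔸 G P) (regC336 𝔸 G P)) _ h32R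
  have h33J := thm33Printed_reindex f c35Y geo9Y (bg9YR 𝔸 G (regC335 𝔸 G P) (regC336 𝔸 G P)) _ _ h33R
  rw [eGp, eGA, eC] at hbaseJ
  rw [eGp] at h31J
  rw [eC] at h32J
  rw [eGp, eGA] at h33J
  have h32J' : B9.Thm32Printed (d + 1) c35Y (fun j => geo9Y (f j)) (fun j => bg9YC 𝔸 G P (f j)) (CinvY P f G par) := h32J
  have h33J' : B9.Thm33Printed c35Y (fun j => geo9Y (f j)) (fun j => bg9YC 𝔸 G P (f j))
      (fun j => kernelFamilyS (f j).toKIdx (bg9YC 𝔸 G P (f j)) (fun U => U) (GpY (f j).toKIdx (par j)) (par j))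
      (fun j => kernelFamilyB (f j).toKIdx (bg9YC 𝔸 G P (f j)) (fun U => U)
        (OA j) (parBY (f j).toKIdx)) := h33J
  have hBU := hB h32J' h33J'
  -- (3) over the coded carrier
  have hbaseU := baseU1Printed_codedU P G f C38 par
    OA (fun j => parBY (f j).toKIdx)
    (fun j => C37GY G (f j) (ιB j) (cqY d)) (CinvY P f G par) (d + 1) hbaseJ
  have h31U := thm31Printed_codedU P G f C38 c35Y par (fun j => C37GY G (f j) (ιB j) (cqY d)) h31J
  have h32U := thm32Printed_codedU P f c35Y G C38 (C37 := fun j => C37GY G (f j) (ιB j) (cqY d))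
    (Cinv := CinvY P f G par) (d + 1) h32J
  have h33U := thm33Printed_codedU P f c35Y G C38 par
    OA (fun j => parBY (f j).toKIdx)
    (fun j => C37GY G (f j) (ιB j) (cqY d)) h33J
  have honeU : ∀ (j : J) (α₀ : ℝ), 0 < α₀ → ((carriersYUPar P G f b ιB C38 par OA ops).bg9 j).Reg335 c35Y α₀ ((carriersYUPar P G f b ιB C38 par OA ops).bg9 j).one :=
    fun j α₀ hα => hone j α₀ hα
  have h35 := B9.cor35_of_sectB_base (d + 1) c35Y (carriersYUPar P G f b ιB C38 par OA ops).geo9 (carriersYUPar P G f b ιB C38 par OA ops).bg9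
    (carriersYUPar P G f b ιB C38 par OA ops).Gp (carriersYUPar P G f b ιB C38 par OA ops).GA (carriersYUPar P G f b ιB C38 par OA ops).Cinv (carriersYUPar P G f b ιB C38 par OA ops).IsAnalyticExt
    honeU hbaseU hBU
  have hg : B9.GaugeReduction335 (d + 1) c35Y (carriersYUPar P G f b ιB C38 par OA ops).geo9 (carriersYUPar P G f b ιB C38 par OA ops).bg9 (carriersYUPar P G f b ιB C38 par OA ops).InCube
      (carriersYUPar P G f b ιB C38 par OA ops).Gp (carriersYUPar P G f b ιB C38 par OA ops).GA (carriersYUPar P G f b ιB C38 par OA ops).Cinv :=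
    fun j hj => absurd hj (not_inCubeY (f j))
  have h36 := B9.cor36_of_cor35 (d + 1) c35Y c35Y_pos _ _ _ _ _ _ h35 hg
  have h34 := B9.thm34_of_sectB (d + 1) c35Y (carriersYUPar P G f b ιB C38 par OA ops).geo9 (carriersYUPar P G f b ιB C38 par OA ops).bg9
    (carriersYUPar P G f b ιB C38 par OA ops).Gp (carriersYUPar P G f b ιB C38 par OA ops).GA (carriersYUPar P G f b ιB C38 par OA ops).Cinv (carriersYUPar P G f b ιB C38 par OA ops).IsAnalyticExt
    hBU h32U h33U
  exact ⟨⟨h35, h36, h31U, h32U, h33U, h34,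
      thm37Printed_coded c35Y _ _ (fun j => codingYU P G f ιB C38 j) _ (thm37Printed_reindex f c35Y geo9Y _ _ t37),
      cor38Printed_coded c35Y _ _ (fun j => codingYU P G f ιB C38 j) _ (cor38Printed_reindex f c35Y geo9Y _ _ c38),
      thm39Printed_coded (d + 1) c35Y _ _ (fun j => codingYU P G f ιB C38 j) _ (thm39Printed_reindex f (d + 1) c35Y geo9Y _ _ t39),
      thm310Printed_coded c35Y _ _ (fun j => codingYU P G f ιB C38 j) _ (thm310Printed_reindex f c35Y geo9Y _ _ t310),
      thm311Printed_coded c35Y _ _ (fun j => codingYU P G f ιB C38 j) _ (thm311Printed_reindex f c35Y geo9Y _ _ t311),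
      thm312Printed_coded (d + 1) c35Y _ _ (fun j => codingYU P G f ιB C38 j) _ _ _ _ _ _ _ (thm312Printed_reindex f (d + 1) c35Y geo9Y _ _ _ _ _ _ _ _ t312),
      thm313Printed_coded c35Y _ _ (fun j => codingYU P G f ιB C38 j) _ _ _ (thm313Printed_reindex f c35Y geo9Y _ _ _ _ t313),
      thm314Printed_coded c35Y _ _ (fun j => codingYU P G f ιB C38 j) _ _ (thm314Printed_reindex f c35Y geo9Y _ _ _ t314),
      thm315FullPrinted_coded c35Y _ _ (fun j => codingYU P G f ιB C38 j) _ _ _ _ _ (thm315FullPrinted_reindex f c35Y geo9Y _ _ _ _ _ _ t315)⟩,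
    stmt349Printed_coded (d + 1) c35Y _ _ (fun j => codingYU P G f ιB C38 j) _ (stmt349Printed_reindex f (d + 1) c35Y geo9Y _ _ s349),
    stmt3132Printed_coded (d + 1) c35Y _ _ (fun j => codingYU P G f ιB C38 j) _ _ (stmt3132Printed_reindex f (d + 1) c35Y geo9Y _ _ _ s3132),
    thm314LocalPrinted_coded c35Y _ _ (fun j => codingYU P G f ιB C38 j) _ _ _ (thm314LocalPrinted_reindex f c35Y geo9Y _ _ _ _ t314loc)⟩

end Knit

end Literature.MathematicalPhysics.QuantumFieldTheory.Balaban1983to89.B9LeafXCodedKnitUPar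

end
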